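import Literature.Analysis.FluidPDE.ExtremeGrowthVorticityControl
import Mathlib.Analysis.SpecialFunctions.Pow.Deriv
import Mathlib.Analysis.Calculus.Deriv.MeanValue
import HarnessLib

/-!
# The lower edge of the enstrophy blow-up window: a rate `dℰ/dt ≤ C ℰ^α` with `α ≤ 2` cannot blow up

Analysis/FluidPDE theorem file, companion of `ExtremeGrowthBlowupWindow.lean` (upper edge of the
`L^q` window) and of `ExtremeGrowthBounds.lean` (BOUNDS.md (1.7) of the fluid-computer cell).
Ayala–Protas 2017, §2 (the paragraph before eq. (2.9)): "assuming the instantaneous rate of growth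
of enstrophy in the form `dℰ/dt = C ℰ^α` for some `C > 0`, any exponent `α > 2` will produce
blow-up of `ℰ(t)` in finite time if the rate of growth is sustained. The fact that there is no
blow-up for `α ≤ 2` follows from Grönwall's lemma and the fact that one factor of `ℰ` can be bounded
in terms of the initial energy using `∫₀ᵗ ℰ(s) ds = (K(0) − K(t))/(2ν) ≤ K(0)/(2ν)`" (eq. (2.9)).

Along a classical solution of the unforced Navier–Stokes equations on the unit torus (any
dimension, `ν > 0`; `ℰ = ½‖∇u‖₂²`, `K = ½‖u‖₂²`), with the rate hypothesis stated on the one-sided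
derivatives of `t ↦ ℰ(u(t))` within the window exactly as in `LuDoering2008_enstrophyRate_le`:

* `torusEnstrophy_le_mul_exp_of_rate_le_mul_sq` — the borderline `α = 2`: `dℰ/dt ≤ C ℰ²` on `[a, b]`
  gives `ℰ(t) ≤ ℰ(a) exp(C (K(a) − K(t))/(2ν)) ≤ ℰ(a) exp(C K(a)/(2ν))` (differential Grönwall with
  the integrable coefficient `k = Cℰ`, tree `le_mul_exp_integral_of_hasDerivWithinAt_le_mul`, and the
  energy identity `kineticEnergy_sub_eq_neg_two_mul_integral_torusEnstrophy`).
* `torusEnstrophy_rpow_le_of_rate_le_mul_rpow` — `α < 2` (real exponent, `ℰ > 0`):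
  `ℰ(t)^{2−α} ≤ ℰ(a)^{2−α} + (2 − α) C (K(a) − K(t))/(2ν)`, polynomial growth at most
  (`s ↦ ℰ(s)^{2−α} + (2−α)C K(s)/(2ν)` is nonincreasing).
* `sub_le_of_mul_rpow_le_deriv` — the other side of the sentence, pure calculus: a SUSTAINED lower
  rate `y' ≥ c y^α` with `α > 1`, `c > 0`, `y > 0` on `[a, b]` forces
  `(α − 1) c (b − a) ≤ y(a)^{1−α} − y(b)^{1−α} < y(a)^{1−α}`, i.e. the window on which such a rate can
  be sustained is shorter than the blow-up time `y(a)^{1−α}/((α − 1)c)` of `y' = c y^α` (the sign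
  of `c` is not used in the inequality itself).
* `rpow_le_rpow_add_mul_primitive_sub_of_deriv_le` and `le_mul_exp_mul_primitive_sub_of_deriv_le`
  (v2) — the same Grönwall mechanism in PURE REAL-VARIABLE form, for the `L^q` version of the window
  (Protas 2026 essay, §4.1, eqs. (44) and (50)): if `y > 0` obeys `y' ≤ C y^{s+β}` on `[a, b]` and
  `P` is ANY primitive of `y^s` there, then `β < 1` gives
  `y(t)^{1−β} ≤ y(a)^{1−β} + (1 − β) C (P(t) − P(a))` and `β = 1` gives
  `y(t) ≤ y(a) exp(C (P(t) − P(a)))`; so a rate exponent `α = s + β ≤ 1 + s` cannot blow up as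
  long as `∫ y^s` stays bounded. Dictionary: `y = ‖u(·)‖_{L^q}`, and the a-priori bound (44)
  `∫₀ᵀ ‖u‖_{L^q}^{4q/(3(q−2))} ≤ C K₀^{2q/(3(q−2))}` (`2 ≤ q ≤ 6`, valid for Leray–Hopf solutions)
  is the bounded primitive with `s = 4q/(3(q−2))`, whence the lower edge `1 + s = (7q−6)/(3(q−2))`
  of (50) (`one_add_aprioriExponent_eq`; the `q > 6` line of (50) is `1 + q/(q−3) = (2q−3)/(q−3)`,
  `one_add_aprioriExponent_eq'`). The enstrophy theorems above are the case `s = 1`,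
  `P = −K/(2ν)`. The a-priori bound (44) itself is NOT asserted here.

Nothing here asserts that any Navier–Stokes flow realises a given rate; the upper edge `α ≤ 3` is
the Lu–Doering estimate (`ExtremeGrowthBounds`, `ExtremeGrowthBoundsProofs`).

## Mathlib / tree search

Tree: `le_mul_exp_integral_of_hasDerivWithinAt_le_mul`,
`kineticEnergy_sub_eq_neg_two_mul_integral_torusEnstrophy` (`ExtremeGrowthVorticityControl`),
`Torus.IsClassicalNSSolutionOn.hasDerivWithinAt_half_gradNormSq` (`TorusClassicalH1Balance`),
`Torus.IsClassicalNSSolutionOn.energy_balance_holds`. Mathlib: `HasDerivWithinAt.rpow_const`,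
`antitoneOn_of_hasDerivWithinAt_nonpos`, `Real.rpow_add`, `HasDerivWithinAt.log`, `Real.exp_log`.

## References

* D. Ayala, B. Protas, *Extreme vortex states and the growth of enstrophy in three-dimensional
  incompressible flows*, J. Fluid Mech. 818 (2017) 772–806, §2, eq. (2.9) and the preceding
  paragraph. [AyalaProtas2017]
* C. R. Doering, C. Foias, *Energy dissipation in body-forced turbulence*, J. Fluid Mech. 467
  (2002) 289–306, (2.4). [DoeringFoias2002]
* B. Protas, *Extreme flows: where physics meets mathematically rigorous bounds* (essay, 2026),
  arXiv:2608.04859, §4.1, eqs. (44), (48), (50). [Protas2026]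
-/

noncomputable section

open Set MeasureTheory intervalIntegral
open scoped InnerProductSpace RealInnerProductSpace

namespace Literature.Analysis.FluidPDE

open Literature.Analysis.FunctionSpaces

/-! ## Pure calculus: a sustained super-linear lower rate bounds the window -/

section Sustained

/-- **A sustained rate `y' ≥ c y^α`, `α > 1`, bounds the window.** Let `a < b`, `1 < α`, `c ∈ ℝ`,
`y > 0` on `[a, b]` with one-sided derivatives `y'` within `[a, b]` and `c y^α ≤ y'` there. Then
`(α − 1) c (b − a) ≤ y(a)^{1−α} − y(b)^{1−α}`: the function `s ↦ y(s)^{1−α} + (α − 1) c s` is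
nonincreasing. Hence, for `c > 0`, `b − a < y(a)^{1−α}/((α − 1) c)`, the blow-up time of `y' = c y^α`
(Ayala–Protas 2017, §2: "any exponent `α > 2` will produce blow-up in finite time if the rate of
growth is sustained"). Real (`rpow`) exponents. [cite: AyalaProtas2017, §2 before eq. (2.9)] -/
theorem sub_le_of_mul_rpow_le_deriv {f f' : ℝ → ℝ} {a b c α : ℝ} (hab : a < b)
    (hα : 1 < α) (hf : ∀ t ∈ Icc a b, HasDerivWithinAt f (f' t) (Icc a b) t)
    (hpos : ∀ t ∈ Icc a b, 0 < f t) (hge : ∀ t ∈ Icc a b, c * f t ^ α ≤ f' t) :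
    (α - 1) * c * (b - a) ≤ f a ^ (1 - α) - f b ^ (1 - α) := by
  have ha : a ∈ Icc a b := left_mem_Icc.2 hab.le
  have hb : b ∈ Icc a b := right_mem_Icc.2 hab.le
  set h : ℝ → ℝ := fun s => f s ^ (1 - α) + (α - 1) * c * s with hh
  have hh' : ∀ s ∈ Icc a b, HasDerivWithinAt h
      (f' s * (1 - α) * f s ^ (1 - α - 1) + (α - 1) * c) (Icc a b) s := by
    intro s hs
    have h1 : HasDerivWithinAt (fun y => f y ^ (1 - α)) (f' s * (1 - α) * f s ^ (1 - α - 1))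
        (Icc a b) s := (hf s hs).rpow_const (Or.inl (hpos s hs).ne')
    have h2 : HasDerivWithinAt (fun y : ℝ => (α - 1) * c * y) ((α - 1) * c) (Icc a b) s := by
      simpa using (hasDerivWithinAt_id s (Icc a b)).const_mul ((α - 1) * c)
    exact h1.add h2
  have hanti : AntitoneOn h (Icc a b) := by
    refine antitoneOn_of_hasDerivWithinAt_nonpos (convex_Icc a b)
      (fun s hs => (hh' s hs).continuousWithinAt)
      (fun s hs => (hh' s (interior_subset hs)).mono interior_subset) fun s hs => ?_
    rw [interior_Icc] at hs
    have hs' : s ∈ Icc a b := Ioo_subset_Icc_self hs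
    have hfs : 0 < f s := hpos s hs'
    -- `f' f^{-α} ≥ c`
    have hexp : (1 : ℝ) - α - 1 = -α := by ring
    have hpow : f s ^ α * f s ^ (-α) = 1 := by
      rw [← Real.rpow_add hfs, add_neg_cancel, Real.rpow_zero]
    have hge' : c ≤ f' s * f s ^ (-α) := by
      have := mul_le_mul_of_nonneg_right (hge s hs') (Real.rpow_nonneg hfs.le (-α))
      rw [mul_assoc, hpow, mul_one] at this
      exact this
    rw [hexp]
    have : f' s * (1 - α) * f s ^ (-α) = -((α - 1) * (f' s * f s ^ (-α))) := by ring
    rw [this]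
    nlinarith [hge', hα]
  have hcmp : h b ≤ h a := hanti ha hb hab.le
  simp only [hh] at hcmp
  linarith

/-- The strict form: a rate `y' ≥ c y^α` (`α > 1`, `y > 0`) can be sustained on `[a, b]` only if
`(α − 1) c (b − a) < y(a)^{1−α}` (for `c > 0`: `b − a < y(a)^{1−α}/((α − 1)c)`). [cite: AyalaProtas2017, §2 before eq. (2.9)] -/
theorem sub_lt_of_mul_rpow_le_deriv {f f' : ℝ → ℝ} {a b c α : ℝ} (hab : a < b)
    (hα : 1 < α) (hf : ∀ t ∈ Icc a b, HasDerivWithinAt f (f' t) (Icc a b) t)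
    (hpos : ∀ t ∈ Icc a b, 0 < f t) (hge : ∀ t ∈ Icc a b, c * f t ^ α ≤ f' t) :
    (α - 1) * c * (b - a) < f a ^ (1 - α) := by
  have h1 := sub_le_of_mul_rpow_le_deriv hab hα hf hpos hge
  have h2 : 0 < f b ^ (1 - α) := Real.rpow_pos_of_pos (hpos b (right_mem_Icc.2 hab.le)) _
  linarith

end Sustained

/-! ## Pure calculus: a rate `y' ≤ C y^{s+β}` against a bounded primitive of `y^s` -/

section IntegrableFactor

/-- **Sub-critical rate against an integrable power (`β < 1`).** Let `a < b`, `β < 1`, `C s ∈ ℝ`,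
`y > 0` on `[a, b]` with one-sided derivatives `y'` within `[a, b]` satisfying `y' ≤ C y^{s+β}`,
and let `P` be any primitive of `y^s` on `[a, b]` (one-sided derivatives within `[a, b]`). Then for
every `t ∈ [a, b]`, `y(t)^{1−β} ≤ y(a)^{1−β} + (1 − β) C (P(t) − P(a))`: the function
`y^{1−β} − (1 − β) C P` is nonincreasing (`(y^{1−β})' = (1−β) y^{−β} y' ≤ (1−β) C y^s`). With
`y = ‖u(·)‖_{L^q}`, `s = 4q/(3(q−2))` and the a-priori bound (44) on `∫ y^s`, this is the
`α = s + β < 1 + s` case of the lower edge (50) of the `L^q` blow-up window; with `s = 1`,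
`P = −K/(2ν)` it is `torusEnstrophy_rpow_le_of_rate_le_mul_rpow`. No sign condition on `C`.
[cite: Protas2026, §4.1, eqs. (44) and (50)] -/
theorem rpow_le_rpow_add_mul_primitive_sub_of_deriv_le {f f' P : ℝ → ℝ} {a b C s β : ℝ}
    (hab : a < b) (hβ : β < 1)
    (hf : ∀ t ∈ Icc a b, HasDerivWithinAt f (f' t) (Icc a b) t)
    (hP : ∀ t ∈ Icc a b, HasDerivWithinAt P (f t ^ s) (Icc a b) t)
    (hpos : ∀ t ∈ Icc a b, 0 < f t) (hle : ∀ t ∈ Icc a b, f' t ≤ C * f t ^ (s + β))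
    {t : ℝ} (ht : t ∈ Icc a b) :
    f t ^ (1 - β) ≤ f a ^ (1 - β) + (1 - β) * C * (P t - P a) := by
  have ha : a ∈ Icc a b := left_mem_Icc.2 hab.le
  -- `H = f^{1-β} - (1-β) C P` and its derivative within `[a, b]`
  set H : ℝ → ℝ := fun x => f x ^ (1 - β) - (1 - β) * C * P x with hH
  have hH' : ∀ x ∈ Icc a b, HasDerivWithinAt H
      (f' x * (1 - β) * f x ^ (1 - β - 1) - (1 - β) * C * f x ^ s) (Icc a b) x := by
    intro x hx
    exact ((hf x hx).rpow_const (Or.inl (hpos x hx).ne')).sub ((hP x hx).const_mul _)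
  have hanti : AntitoneOn H (Icc a b) := by
    refine antitoneOn_of_hasDerivWithinAt_nonpos (convex_Icc a b)
      (fun x hx => (hH' x hx).continuousWithinAt)
      (fun x hx => (hH' x (interior_subset hx)).mono interior_subset) fun x hx => ?_
    rw [interior_Icc] at hx
    have hx' : x ∈ Icc a b := Ioo_subset_Icc_self hx
    have hfx : 0 < f x := hpos x hx'
    have h1β : 0 ≤ 1 - β := by linarith
    have hexp : (1 : ℝ) - β - 1 = -β := by ring
    have hpow : f x ^ (s + β) * f x ^ (-β) = f x ^ s := by
      rw [← Real.rpow_add hfx]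
      congr 1
      ring
    have hfac : 0 ≤ (1 - β) * f x ^ (-β) := mul_nonneg h1β (Real.rpow_nonneg hfx.le _)
    have h1 : f' x * (1 - β) * f x ^ (-β) ≤ (1 - β) * C * f x ^ s := by
      have := mul_le_mul_of_nonneg_right (hle x hx') hfac
      calc f' x * (1 - β) * f x ^ (-β)
          = f' x * ((1 - β) * f x ^ (-β)) := by ring
        _ ≤ C * f x ^ (s + β) * ((1 - β) * f x ^ (-β)) := this
        _ = (1 - β) * C * (f x ^ (s + β) * f x ^ (-β)) := by ring
        _ = (1 - β) * C * f x ^ s := by rw [hpow]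
    rw [hexp]
    linarith
  have hcmp : H t ≤ H a := hanti ha ht ht.1
  simp only [hH] at hcmp
  linarith

/-- **`β < 1`, uniform form.** If moreover `0 ≤ C` and the primitive gain is bounded,
`P(t) − P(a) ≤ M`, then `y(t)^{1−β} ≤ y(a)^{1−β} + (1 − β) C M` — a bound independent of the
window: no blow-up for `α = s + β < 1 + s` as long as `∫ y^s ≤ M` a priori.
[cite: Protas2026, §4.1, eqs. (44) and (50)] -/
theorem rpow_le_rpow_add_mul_of_deriv_le {f f' P : ℝ → ℝ} {a b C s β M : ℝ}
    (hab : a < b) (hβ : β < 1) (hC : 0 ≤ C)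
    (hf : ∀ t ∈ Icc a b, HasDerivWithinAt f (f' t) (Icc a b) t)
    (hP : ∀ t ∈ Icc a b, HasDerivWithinAt P (f t ^ s) (Icc a b) t)
    (hpos : ∀ t ∈ Icc a b, 0 < f t) (hle : ∀ t ∈ Icc a b, f' t ≤ C * f t ^ (s + β))
    {t : ℝ} (ht : t ∈ Icc a b) (hM : P t - P a ≤ M) :
    f t ^ (1 - β) ≤ f a ^ (1 - β) + (1 - β) * C * M := by
  have h1 := rpow_le_rpow_add_mul_primitive_sub_of_deriv_le hab hβ hf hP hpos hle ht
  have hc : 0 ≤ (1 - β) * C := mul_nonneg (by linarith) hC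
  nlinarith [h1, mul_le_mul_of_nonneg_left hM hc]

/-- **The borderline `β = 1`: exponential, not blow-up.** Let `a < b`, `C s ∈ ℝ`, `y > 0` on
`[a, b]` with one-sided derivatives `y'` within `[a, b]` satisfying `y' ≤ C y^{s+1}`, and let `P`
be any primitive of `y^s` on `[a, b]`. Then `y(t) ≤ y(a) exp(C (P(t) − P(a)))` for every
`t ∈ [a, b]` (`(log y)' = y'/y ≤ C y^s = C P'`, so `log y − C P` is nonincreasing). With
`y = ‖u(·)‖_{L^q}` and `s = 4q/(3(q−2))` this is the edge case `α = 1 + s = (7q−6)/(3(q−2))` of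
(50); with `s = 1`, `P = −K/(2ν)` it is `torusEnstrophy_le_mul_exp_of_rate_le_mul_sq`
(Ayala–Protas 2017, §2: no blow-up for `α ≤ 2`). No sign condition on `C`.
[cite: Protas2026, §4.1, eqs. (44) and (50)] -/
theorem le_mul_exp_mul_primitive_sub_of_deriv_le {f f' P : ℝ → ℝ} {a b C s : ℝ} (hab : a < b)
    (hf : ∀ t ∈ Icc a b, HasDerivWithinAt f (f' t) (Icc a b) t)
    (hP : ∀ t ∈ Icc a b, HasDerivWithinAt P (f t ^ s) (Icc a b) t)
    (hpos : ∀ t ∈ Icc a b, 0 < f t) (hle : ∀ t ∈ Icc a b, f' t ≤ C * f t ^ (s + 1))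
    {t : ℝ} (ht : t ∈ Icc a b) :
    f t ≤ f a * Real.exp (C * (P t - P a)) := by
  have ha : a ∈ Icc a b := left_mem_Icc.2 hab.le
  -- `G = log f - C P` and its derivative within `[a, b]`
  set G : ℝ → ℝ := fun x => Real.log (f x) - C * P x with hG
  have hG' : ∀ x ∈ Icc a b, HasDerivWithinAt G (f' x / f x - C * f x ^ s) (Icc a b) x := by
    intro x hx
    exact ((hf x hx).log (hpos x hx).ne').sub ((hP x hx).const_mul C)
  have hanti : AntitoneOn G (Icc a b) := by
    refine antitoneOn_of_hasDerivWithinAt_nonpos (convex_Icc a b)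
      (fun x hx => (hG' x hx).continuousWithinAt)
      (fun x hx => (hG' x (interior_subset hx)).mono interior_subset) fun x hx => ?_
    rw [interior_Icc] at hx
    have hx' : x ∈ Icc a b := Ioo_subset_Icc_self hx
    have hfx : 0 < f x := hpos x hx'
    have h1 : f' x / f x ≤ C * f x ^ s := by
      rw [div_le_iff₀ hfx]
      calc f' x ≤ C * f x ^ (s + 1) := hle x hx'
        _ = C * f x ^ s * f x := by rw [Real.rpow_add hfx, Real.rpow_one]; ring
    linarith
  have hcmp : G t ≤ G a := hanti ha ht ht.1
  simp only [hG] at hcmp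
  have hft : 0 < f t := hpos t ht
  have hlog : Real.log (f t) ≤ Real.log (f a) + C * (P t - P a) := by linarith
  calc f t = Real.exp (Real.log (f t)) := (Real.exp_log hft).symm
    _ ≤ Real.exp (Real.log (f a) + C * (P t - P a)) := Real.exp_le_exp.2 hlog
    _ = f a * Real.exp (C * (P t - P a)) := by rw [Real.exp_add, Real.exp_log (hpos a ha)]

/-- **`β = 1`, uniform form.** If moreover `0 ≤ C` and `P(t) − P(a) ≤ M`, then
`y(t) ≤ y(a) exp(C M)`, independent of the window. [cite: Protas2026, §4.1, eqs. (44) and (50)] -/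
theorem le_mul_exp_mul_of_deriv_le {f f' P : ℝ → ℝ} {a b C s M : ℝ} (hab : a < b) (hC : 0 ≤ C)
    (hf : ∀ t ∈ Icc a b, HasDerivWithinAt f (f' t) (Icc a b) t)
    (hP : ∀ t ∈ Icc a b, HasDerivWithinAt P (f t ^ s) (Icc a b) t)
    (hpos : ∀ t ∈ Icc a b, 0 < f t) (hle : ∀ t ∈ Icc a b, f' t ≤ C * f t ^ (s + 1))
    {t : ℝ} (ht : t ∈ Icc a b) (hM : P t - P a ≤ M) :
    f t ≤ f a * Real.exp (C * M) := by
  have h1 := le_mul_exp_mul_primitive_sub_of_deriv_le hab hf hP hpos hle ht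
  have hfa : 0 ≤ f a := (hpos a (left_mem_Icc.2 hab.le)).le
  exact h1.trans (mul_le_mul_of_nonneg_left
    (Real.exp_le_exp.2 (mul_le_mul_of_nonneg_left hM hC)) hfa)

/-- The lower edge of the `L^q` window for `2 ≤ q ≤ 6` (Protas 2026 essay, eq. (50), first line):
one plus the a-priori exponent `s = 4q/(3(q−2))` of (44) is `(7q − 6)/(3(q − 2))`
(`q = 4, 5, 6 ↦ 11/3, 29/9, 3`). [cite: Protas2026, §4.1, eqs. (44) and (50)] -/
theorem one_add_aprioriExponent_eq {q : ℝ} (hq : q ≠ 2) :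
    1 + 4 * q / (3 * (q - 2)) = (7 * q - 6) / (3 * (q - 2)) := by
  have h : q - 2 ≠ 0 := sub_ne_zero.2 hq
  field_simp
  ring

/-- The lower edge of the `L^q` window for `q > 6` (essay, eq. (50), second line): one plus the
exponent `s = q/(q − 3)` is `(2q − 3)/(q − 3)` (`q = 9 ↦ 5/2`). [cite: Protas2026, §4.1, eq. (50)] -/
theorem one_add_aprioriExponent_eq' {q : ℝ} (hq : q ≠ 3) :
    1 + q / (q - 3) = (2 * q - 3) / (q - 3) := by
  have h : q - 3 ≠ 0 := sub_ne_zero.2 hq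
  field_simp
  ring

end IntegrableFactor

/-! ## Along Navier–Stokes on the torus: `α ≤ 2` cannot blow up -/

section Torus

variable {d : Type*} [Fintype d] [DecidableEq d]

/-- **Borderline `α = 2`: exponential bound, no blow-up.** Along a classical solution of the
unforced Navier–Stokes equations (`ν > 0`) on the unit torus over `[a, b]`, `a < b`, if every
one-sided derivative `R` of `t ↦ ℰ(u(t))` within `[a, b]` obeys `R ≤ C ℰ(u(t))²`, then
`ℰ(u(t)) ≤ ℰ(u(a)) · exp(C (K(u(a)) − K(u(t)))/(2ν))` for all `t ∈ [a, b]`: Grönwall with the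
coefficient `k = C ℰ` and `∫ₐᵗ ℰ = (K(a) − K(t))/(2ν)` (Ayala–Protas 2017, §2, eq. (2.9)). No sign
condition on `C`, any dimension. [cite: AyalaProtas2017, §2, eq. (2.9)] -/
theorem torusEnstrophy_le_mul_exp_of_rate_le_mul_sq {ν a b : ℝ} (hν : 0 < ν) (hab : a < b)
    {u : ℝ → UnitAddTorus d → EuclideanSpace ℝ d} {p : ℝ → UnitAddTorus d → ℝ}
    (h : Torus.IsClassicalNSSolutionOn (Icc a b) ν 0 u p) {C : ℝ}
    (hrate : ∀ s ∈ Icc a b, ∀ R : ℝ,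
      HasDerivWithinAt (fun r => torusEnstrophy (u r)) R (Icc a b) s →
        R ≤ C * torusEnstrophy (u s) ^ 2)
    {t : ℝ} (ht : t ∈ Icc a b) :
    torusEnstrophy (u t) ≤ torusEnstrophy (u a) *
      Real.exp (C * (Torus.kineticEnergy (u a) - Torus.kineticEnergy (u t)) / (2 * ν)) := by
  set F : ℝ → ℝ := fun s => -ν * (∫ x, ‖Torus.laplacian (u s) x‖ ^ 2) +
      ∫ x, ⟪Torus.convect (u s) (u s) x - (0 : ℝ → UnitAddTorus d → EuclideanSpace ℝ d) s x,
        Torus.laplacian (u s) x⟫ with hF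
  have hder : ∀ s ∈ Icc a b,
      HasDerivWithinAt (fun r => torusEnstrophy (u r)) (F s) (Icc a b) s :=
    fun s hs => h.hasDerivWithinAt_half_gradNormSq hab hs
  have hcont : ContinuousOn (fun s => C * torusEnstrophy (u s)) (Icc a b) :=
    fun s hs => ((hder s hs).continuousWithinAt).const_smul C
  have hle : ∀ s ∈ Icc a b, F s ≤ C * torusEnstrophy (u s) * torusEnstrophy (u s) := by
    intro s hs
    have := hrate s hs (F s) (hder s hs)
    nlinarith [this]
  have hG := le_mul_exp_integral_of_hasDerivWithinAt_le_mul hab hder hcont hle ht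
  have hI : ∫ s in a..t, C * torusEnstrophy (u s) =
      C * (Torus.kineticEnergy (u a) - Torus.kineticEnergy (u t)) / (2 * ν) := by
    rw [intervalIntegral.integral_const_mul]
    have hE := kineticEnergy_sub_eq_neg_two_mul_integral_torusEnstrophy h (convex_Icc a b) ht.1
      (Icc_subset_Icc_right ht.2)
    have hint : ∫ τ in a..t, torusEnstrophy (u τ) =
        (Torus.kineticEnergy (u a) - Torus.kineticEnergy (u t)) / (2 * ν) := by
      have hν0 : (2 : ℝ) * ν ≠ 0 := by positivity
      field_simp
      linarith
    rw [hint]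
    ring
  rw [hI] at hG
  exact hG

/-- **`α = 2`, uniform in time**: under the same rate hypothesis with `C ≥ 0`,
`ℰ(u(t)) ≤ ℰ(u(a)) exp(C K(u(a))/(2ν))` on the whole window — the bound does not depend on `b`, so
a rate `dℰ/dt ≤ Cℰ²` sustained up to any time cannot blow up (Ayala–Protas 2017, §2).
[cite: AyalaProtas2017, §2, eq. (2.9)] -/
theorem torusEnstrophy_le_mul_exp_energy_of_rate_le_mul_sq {ν a b : ℝ} (hν : 0 < ν) (hab : a < b)
    {u : ℝ → UnitAddTorus d → EuclideanSpace ℝ d} {p : ℝ → UnitAddTorus d → ℝ}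
    (h : Torus.IsClassicalNSSolutionOn (Icc a b) ν 0 u p) {C : ℝ} (hC : 0 ≤ C)
    (hrate : ∀ s ∈ Icc a b, ∀ R : ℝ,
      HasDerivWithinAt (fun r => torusEnstrophy (u r)) R (Icc a b) s →
        R ≤ C * torusEnstrophy (u s) ^ 2)
    {t : ℝ} (ht : t ∈ Icc a b) :
    torusEnstrophy (u t) ≤ torusEnstrophy (u a) *
      Real.exp (C * Torus.kineticEnergy (u a) / (2 * ν)) := by
  have h1 := torusEnstrophy_le_mul_exp_of_rate_le_mul_sq hν hab h hrate ht
  have hKt : 0 ≤ Torus.kineticEnergy (u t) := Torus.kineticEnergy_nonneg _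
  have hEa : 0 ≤ torusEnstrophy (u a) := torusEnstrophy_nonneg _
  refine h1.trans (mul_le_mul_of_nonneg_left (Real.exp_le_exp.2 ?_) hEa)
  have : C * (Torus.kineticEnergy (u a) - Torus.kineticEnergy (u t)) ≤
      C * Torus.kineticEnergy (u a) := by nlinarith
  exact div_le_div_of_nonneg_right this (by positivity)

/-- **`α < 2`: polynomial bound, no blow-up.** Along a classical solution of the unforced
Navier–Stokes equations (`ν > 0`) on the unit torus over `[a, b]` with positive enstrophy, if every
one-sided derivative `R` of `t ↦ ℰ(u(t))` within `[a, b]` obeys `R ≤ C ℰ(u(t))^α` with a real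
exponent `α < 2`, then for all `t ∈ [a, b]`
`ℰ(u(t))^{2−α} ≤ ℰ(u(a))^{2−α} + (2 − α) C (K(u(a)) − K(u(t)))/(2ν)`
(`(ℰ^{2−α})' = (2−α) ℰ^{1−α} ℰ' ≤ (2−α) C ℰ` and `dK/dt = −2νℰ`, so
`ℰ^{2−α} + (2−α) C K/(2ν)` is nonincreasing; Ayala–Protas 2017, §2, eq. (2.9)). No sign condition
on `C`, any dimension. [cite: AyalaProtas2017, §2, eq. (2.9)] -/
theorem torusEnstrophy_rpow_le_of_rate_le_mul_rpow {ν a b : ℝ} (hν : 0 < ν) (hab : a < b)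
    {u : ℝ → UnitAddTorus d → EuclideanSpace ℝ d} {p : ℝ → UnitAddTorus d → ℝ}
    (h : Torus.IsClassicalNSSolutionOn (Icc a b) ν 0 u p)
    (hpos : ∀ t ∈ Icc a b, 0 < torusEnstrophy (u t)) {C α : ℝ} (hα : α < 2)
    (hrate : ∀ s ∈ Icc a b, ∀ R : ℝ,
      HasDerivWithinAt (fun r => torusEnstrophy (u r)) R (Icc a b) s →
        R ≤ C * torusEnstrophy (u s) ^ α)
    {t : ℝ} (ht : t ∈ Icc a b) :
    torusEnstrophy (u t) ^ (2 - α) ≤ torusEnstrophy (u a) ^ (2 - α) +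
      (2 - α) * C / (2 * ν) * (Torus.kineticEnergy (u a) - Torus.kineticEnergy (u t)) := by
  have ha : a ∈ Icc a b := left_mem_Icc.2 hab.le
  set F : ℝ → ℝ := fun s => -ν * (∫ x, ‖Torus.laplacian (u s) x‖ ^ 2) +
      ∫ x, ⟪Torus.convect (u s) (u s) x - (0 : ℝ → UnitAddTorus d → EuclideanSpace ℝ d) s x,
        Torus.laplacian (u s) x⟫ with hF
  have hder : ∀ s ∈ Icc a b,
      HasDerivWithinAt (fun r => torusEnstrophy (u r)) (F s) (Icc a b) s :=
    fun s hs => h.hasDerivWithinAt_half_gradNormSq hab hs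
  have hK : ∀ s ∈ Icc a b, HasDerivWithinAt (fun r => Torus.kineticEnergy (u r))
      (-ν * Torus.gradNormSq (u s)) (Icc a b) s := by
    intro s hs
    have hb := Torus.IsClassicalNSSolutionOn.energy_balance_holds h (convex_Icc a b) hs
    simpa using hb
  set c : ℝ := (2 - α) * C / (2 * ν) with hc
  -- `H = ℰ^{2-α} + c K` and its derivative within `[a, b]`
  set H : ℝ → ℝ := fun s => torusEnstrophy (u s) ^ (2 - α) + c * Torus.kineticEnergy (u s)
    with hH
  have hH' : ∀ s ∈ Icc a b, HasDerivWithinAt H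
      (F s * (2 - α) * torusEnstrophy (u s) ^ (2 - α - 1) + c * (-ν * Torus.gradNormSq (u s)))
      (Icc a b) s := by
    intro s hs
    have h1 : HasDerivWithinAt (fun r => torusEnstrophy (u r) ^ (2 - α))
        (F s * (2 - α) * torusEnstrophy (u s) ^ (2 - α - 1)) (Icc a b) s :=
      (hder s hs).rpow_const (Or.inl (hpos s hs).ne')
    exact h1.add ((hK s hs).const_mul c)
  have hanti : AntitoneOn H (Icc a b) := by
    refine antitoneOn_of_hasDerivWithinAt_nonpos (convex_Icc a b)
      (fun s hs => (hH' s hs).continuousWithinAt)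
      (fun s hs => (hH' s (interior_subset hs)).mono interior_subset) fun s hs => ?_
    rw [interior_Icc] at hs
    have hs' : s ∈ Icc a b := Ioo_subset_Icc_self hs
    have hEs : 0 < torusEnstrophy (u s) := hpos s hs'
    have hexp : (2 : ℝ) - α - 1 = 1 - α := by ring
    have h2α : 0 ≤ 2 - α := by linarith
    -- `F (2-α) ℰ^{1-α} ≤ C ℰ^α (2-α) ℰ^{1-α} = (2-α) C ℰ`
    have hpow : torusEnstrophy (u s) ^ α * torusEnstrophy (u s) ^ (1 - α) =
        torusEnstrophy (u s) := by
      rw [← Real.rpow_add hEs, add_sub_cancel, Real.rpow_one]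
    have hfac : 0 ≤ (2 - α) * torusEnstrophy (u s) ^ (1 - α) :=
      mul_nonneg h2α (Real.rpow_nonneg hEs.le _)
    have h1 : F s * (2 - α) * torusEnstrophy (u s) ^ (1 - α) ≤
        (2 - α) * C * torusEnstrophy (u s) := by
      have := mul_le_mul_of_nonneg_right (hrate s hs' (F s) (hder s hs')) hfac
      calc F s * (2 - α) * torusEnstrophy (u s) ^ (1 - α)
          = F s * ((2 - α) * torusEnstrophy (u s) ^ (1 - α)) := by ring
        _ ≤ C * torusEnstrophy (u s) ^ α * ((2 - α) * torusEnstrophy (u s) ^ (1 - α)) := this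
        _ = (2 - α) * C * (torusEnstrophy (u s) ^ α * torusEnstrophy (u s) ^ (1 - α)) := by ring
        _ = (2 - α) * C * torusEnstrophy (u s) := by rw [hpow]
    have h2 : c * (-ν * Torus.gradNormSq (u s)) = -((2 - α) * C * torusEnstrophy (u s)) := by
      rw [gradNormSq_eq_two_mul_torusEnstrophy, hc]
      field_simp
    rw [hexp, h2]
    linarith
  have hcmp : H t ≤ H a := hanti ha ht ht.1
  simp only [hH] at hcmp
  have : c * (Torus.kineticEnergy (u a) - Torus.kineticEnergy (u t)) =
      c * Torus.kineticEnergy (u a) - c * Torus.kineticEnergy (u t) := by ring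
  linarith

/-- **`α < 2`, uniform in time**: with `C ≥ 0`, `ℰ(u(t))^{2−α} ≤ ℰ(u(a))^{2−α} + (2 − α) C K(u(a))/(2ν)`
on the whole window, independent of `b` (Ayala–Protas 2017, §2: no blow-up for `α ≤ 2`).
[cite: AyalaProtas2017, §2, eq. (2.9)] -/
theorem torusEnstrophy_rpow_le_energy_of_rate_le_mul_rpow {ν a b : ℝ} (hν : 0 < ν) (hab : a < b)
    {u : ℝ → UnitAddTorus d → EuclideanSpace ℝ d} {p : ℝ → UnitAddTorus d → ℝ}
    (h : Torus.IsClassicalNSSolutionOn (Icc a b) ν 0 u p)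
    (hpos : ∀ t ∈ Icc a b, 0 < torusEnstrophy (u t)) {C α : ℝ} (hC : 0 ≤ C) (hα : α < 2)
    (hrate : ∀ s ∈ Icc a b, ∀ R : ℝ,
      HasDerivWithinAt (fun r => torusEnstrophy (u r)) R (Icc a b) s →
        R ≤ C * torusEnstrophy (u s) ^ α)
    {t : ℝ} (ht : t ∈ Icc a b) :
    torusEnstrophy (u t) ^ (2 - α) ≤ torusEnstrophy (u a) ^ (2 - α) +
      (2 - α) * C / (2 * ν) * Torus.kineticEnergy (u a) := by
  have h1 := torusEnstrophy_rpow_le_of_rate_le_mul_rpow hν hab h hpos hα hrate ht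
  have hKt : 0 ≤ Torus.kineticEnergy (u t) := Torus.kineticEnergy_nonneg _
  have hc : 0 ≤ (2 - α) * C / (2 * ν) := by
    have : 0 ≤ 2 - α := by linarith
    positivity
  nlinarith [h1, mul_nonneg hc hKt]

end Torus

end Literature.Analysis.FluidPDE

end
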